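import Summits.AtomisticToContinuum.HydrodynamicLimit.Theorems.EnskogAdjointDualityAdjointEnskogTestFamilyRTransportKappaZero
import HarnessLib

/-!
# K2R refutation, stub `transportKappaOne`: identity (I), transport of the corrector

Route `EnskogAdjointDuality` of `AtomisticToContinuum/HydrodynamicLimit`, crux K2R
`AdjointEnskogTestFamilyR` (stmt-AtomisticToContinuum-11592), line `refutation`, registered stub
`stub_transportKappaOne`.

Testing the defect inequality against `Z(s, x) Θ₁^R(v)` with `Z = ζ(s) sin(2πx₀)` and the dipole
weight `Θ₁^R(v) = |v| (1 + |v|²)⁻⁴ e^{-|v|²/R} v₀` produces, on the corrector part `λ⁻¹ κ` of the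
test function, the transport coefficient `A₁ = -(z' sin(2πx₀) + z v₀ (2π cos(2πx₀)))`
(`z = ζ(s)`, `z' = ζ'(s)`).  Pointwise, with `ϑ¹(v) = |v|(1+|v|²)⁻⁴e^{-|v|²/R}`,
`|Θ₁ A₁ λ⁻¹ κ| ≤ λ⁻¹ C ϑ¹ (|z'| (|v| + |v|³) + 2π |z| (|v|² + |v|⁴))`
(`|κ| ≤ C(1+|v|²)`, `|v₀| ≤ |v|`, `|sin|, |cos| ≤ 1`), and the moments of `ϑ¹` are `≤ 20` up to
order three while `∫ |v|⁴ ϑ¹ = 2π J'_R` (`k2r_ref_R3_facts`); the torus has mass one.  Hence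
`|∫∫ Θ₁ A₁ λ⁻¹ κ| ≤ λ⁻¹ C (40 |z'| + 40π |z| + 4π² |z| J'_R) ≤ (|z| + |z'|)(140 C/λ + (4π² C/λ) J'_R)`.
[folklore]
-/

noncomputable section

open MeasureTheory Set Filter Function
open scoped InnerProductSpace Real

namespace Summit.AtomisticToContinuum.HydrodynamicLimit.Theorems.EnskogAdjointDuality

open Literature.MathematicalPhysics.KineticTheory Literature.Analysis.FluidPDE Literature.Analysis.FunctionSpaces

/-! ## Bookkeeping -/

/-- The final arithmetic of `stub_transportKappaOne`:
`λ⁻¹C|z'|(I₁ + I₃) + λ⁻¹C(2π)|z|(I₂ + 2πJ) ≤ (|z| + |z'|)(140 C/λ + (4π² C/λ) J)` when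
`I₁, I₂, I₃ ≤ 20`, `J ≥ 0` (`40π ≤ 140`). [folklore] -/
theorem k2r_ref_tk_one_arith {lam C z z' I1 I2 I3 J : ℝ} (hlam : 0 < lam) (hC : 0 ≤ C)
    (hJ : 0 ≤ J) (h1 : I1 ≤ 20) (h2 : I2 ≤ 20) (h3 : I3 ≤ 20) :
    lam⁻¹ * C * |z'| * (I1 + I3) + lam⁻¹ * C * (2 * Real.pi) * |z| * (I2 + 2 * Real.pi * J) ≤
      (|z| + |z'|) * (140 * C / lam + 4 * Real.pi ^ 2 * C / lam * J) := by
  have t1 : 0 ≤ lam⁻¹ * C * |z'| * (140 - I1 - I3) := mul_nonneg (by positivity) (by linarith)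
  have t2 : 0 ≤ lam⁻¹ * C * |z| * (140 - 2 * Real.pi * I2) :=
    mul_nonneg (by positivity) (by nlinarith [Real.pi_pos, Real.pi_lt_d2])
  have t3 : 0 ≤ lam⁻¹ * C * (4 * Real.pi ^ 2) * J * |z'| := by positivity
  rw [← sub_nonneg]
  have : (|z| + |z'|) * (140 * C / lam + 4 * Real.pi ^ 2 * C / lam * J) -
      (lam⁻¹ * C * |z'| * (I1 + I3) + lam⁻¹ * C * (2 * Real.pi) * |z| * (I2 + 2 * Real.pi * J)) =
      lam⁻¹ * C * |z'| * (140 - I1 - I3) + lam⁻¹ * C * |z| * (140 - 2 * Real.pi * I2) +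
        lam⁻¹ * C * (4 * Real.pi ^ 2) * J * |z'| := by
    ring
  rw [this]
  linarith

/-! ## The registered stub -/

/-- **Stub `stub_transportKappaOne` of the K2R refutation line** (identity (I), transport of `κ`):
against the dipole weight `|v|(1+|v|²)⁻⁴e^{-|v|²/R} v₀` and the coefficient
`-(z' sin(2πx₀) + z v₀ (2π cos(2πx₀)))`, the corrector part `λ⁻¹κ` is integrable on `𝕋³ × ℝ³`
and its integral is bounded by `(|z| + |z'|)(140 C/λ + (4π² C/λ) J'_R)`. [folklore] -/
theorem stub_transportKappaOne :
  ∀ (Y₀ ρ₀ ε lam C : ℝ), 0 < Y₀ → 0 < ρ₀ → 0 < ε → 2 * Real.pi * ε ≤ Real.pi / 2 → 0 < lam → 0 ≤ C →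
  ∃ Bdd : ℝ, ∀ (cc : UnitAddTorus (Fin 3) → ℝ × EuclideanSpace ℝ (Fin 3) × ℝ) (κ : UnitAddTorus (Fin 3) → EuclideanSpace ℝ (Fin 3) → ℝ),
    Continuous cc → Continuous (Function.uncurry κ) → (∀ x, ‖cc x‖ ≤ C) →
    (∀ x y, dist (cc x) (cc y) ≤ C * dist x y) → (∀ x v, |κ x v| ≤ C * (1 + ‖v‖ ^ 2)) →
    ∀ R : ℝ, 1 ≤ R → ∀ z z' : ℝ,
    Integrable (fun p : UnitAddTorus (Fin 3) × EuclideanSpace ℝ (Fin 3) => (Real.sqrt (‖p.2‖ ^ 2) * ((1 + ‖p.2‖ ^ 2) ^ 4)⁻¹ * Real.exp (-‖p.2‖ ^ 2 / R) * p.2 0) * ((-(z' * Torus.sinCoord 0 p.1 + z * (p.2 0 * ((2 * Real.pi) * Torus.cosCoord 0 p.1)))) * (lam⁻¹ * κ p.1 p.2))) (volume.prod volume) ∧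
    |∫ x : UnitAddTorus (Fin 3), ∫ v : EuclideanSpace ℝ (Fin 3), (Real.sqrt (‖v‖ ^ 2) * ((1 + ‖v‖ ^ 2) ^ 4)⁻¹ * Real.exp (-‖v‖ ^ 2 / R) * v 0) * ((-(z' * Torus.sinCoord 0 x + z * (v 0 * ((2 * Real.pi) * Torus.cosCoord 0 x)))) * (lam⁻¹ * κ x v))| ≤
      (|z| + |z'|) * (Bdd + (4 * Real.pi ^ 2 * C / lam) * (∫ E in Set.Ioi (0 : ℝ), E ^ 3 * ((1 + E) ^ 4)⁻¹ * Real.exp (-E / R))) := by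
  intro Y₀ ρ₀ ε lam C _ _ _ _ hlam hC
  refine ⟨140 * C / lam, fun cc κ _ hκ _ _ hκb R hR z z' => ?_⟩
  -- moments of the dipole weight
  obtain ⟨-, hm, -, hm4, -⟩ := k2r_ref_R3_facts hR
  obtain ⟨hi1, hI1⟩ := hm 1 (by norm_num)
  obtain ⟨hi2, hI2⟩ := hm 2 (by norm_num)
  obtain ⟨hi3, hI3⟩ := hm 3 (by norm_num)
  obtain ⟨hi4, hv4⟩ := hm4
  have hJ' : 0 ≤ ∫ E in Ioi (0 : ℝ), E ^ 3 * ((1 + E) ^ 4)⁻¹ * Real.exp (-E / R) :=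
    (k2r_ref_J_facts hR).2.2.2.2
  have hκc : Continuous fun p : UnitAddTorus (Fin 3) × EuclideanSpace ℝ (Fin 3) => κ p.1 p.2 := hκ
  have hcos : Continuous fun x : UnitAddTorus (Fin 3) => Torus.cosCoord 0 x :=
    (Torus.isSmooth_cosCoord 0).continuous
  have hsin : Continuous fun x : UnitAddTorus (Fin 3) => Torus.sinCoord 0 x :=
    (Torus.isSmooth_sinCoord 0).continuous
  have hv0 : ∀ v : EuclideanSpace ℝ (Fin 3), |v 0| ≤ ‖v‖ := fun v => by
    simpa using PiLp.norm_apply_le v 0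
  have hth : ∀ v : EuclideanSpace ℝ (Fin 3),
      0 ≤ Real.sqrt (‖v‖ ^ 2) * ((1 + ‖v‖ ^ 2) ^ 4)⁻¹ * Real.exp (-‖v‖ ^ 2 / R) :=
    fun v => by positivity
  -- pointwise domination by a function of the velocity alone
  have hFb : ∀ p : UnitAddTorus (Fin 3) × EuclideanSpace ℝ (Fin 3),
      |(Real.sqrt (‖p.2‖ ^ 2) * ((1 + ‖p.2‖ ^ 2) ^ 4)⁻¹ * Real.exp (-‖p.2‖ ^ 2 / R) * p.2 0) * ((-(z' * Torus.sinCoord 0 p.1 + z * (p.2 0 * ((2 * Real.pi) * Torus.cosCoord 0 p.1)))) * (lam⁻¹ * κ p.1 p.2))| ≤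
        lam⁻¹ * C * |z'| * (‖p.2‖ ^ 1 * (Real.sqrt (‖p.2‖ ^ 2) * ((1 + ‖p.2‖ ^ 2) ^ 4)⁻¹ * Real.exp (-‖p.2‖ ^ 2 / R)) +
            ‖p.2‖ ^ 3 * (Real.sqrt (‖p.2‖ ^ 2) * ((1 + ‖p.2‖ ^ 2) ^ 4)⁻¹ * Real.exp (-‖p.2‖ ^ 2 / R))) +
          lam⁻¹ * C * (2 * Real.pi) * |z| * (‖p.2‖ ^ 2 * (Real.sqrt (‖p.2‖ ^ 2) * ((1 + ‖p.2‖ ^ 2) ^ 4)⁻¹ * Real.exp (-‖p.2‖ ^ 2 / R)) +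
            ‖p.2‖ ^ 4 * (Real.sqrt (‖p.2‖ ^ 2) * ((1 + ‖p.2‖ ^ 2) ^ 4)⁻¹ * Real.exp (-‖p.2‖ ^ 2 / R))) := by
    rintro ⟨x, v⟩
    dsimp only
    have hT : |Real.sqrt (‖v‖ ^ 2) * ((1 + ‖v‖ ^ 2) ^ 4)⁻¹ * Real.exp (-‖v‖ ^ 2 / R) * v 0| ≤
        Real.sqrt (‖v‖ ^ 2) * ((1 + ‖v‖ ^ 2) ^ 4)⁻¹ * Real.exp (-‖v‖ ^ 2 / R) * ‖v‖ := by
      rw [abs_mul, abs_of_nonneg (hth v)]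
      exact mul_le_mul_of_nonneg_left (hv0 v) (hth v)
    have hA : |(-(z' * Torus.sinCoord 0 x + z * (v 0 * ((2 * Real.pi) * Torus.cosCoord 0 x))))| ≤
        |z'| * 1 + |z| * (‖v‖ * (2 * Real.pi * 1)) := by
      rw [abs_neg]
      refine (abs_add_le _ _).trans (add_le_add ?_ ?_)
      · rw [abs_mul]
        gcongr
        exact k2r_ref_tk_abs_sinCoord_le 0 x
      · rw [abs_mul, abs_mul, abs_mul, abs_of_pos Real.two_pi_pos]
        gcongr
        · exact hv0 v
        · exact Torus.abs_cosCoord_le 0 x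
    have hK : |lam⁻¹ * κ x v| ≤ lam⁻¹ * (C * (1 + ‖v‖ ^ 2)) := by
      rw [abs_mul, abs_of_pos (inv_pos.2 hlam)]
      exact mul_le_mul_of_nonneg_left (hκb x v) (inv_pos.2 hlam).le
    calc |(Real.sqrt (‖v‖ ^ 2) * ((1 + ‖v‖ ^ 2) ^ 4)⁻¹ * Real.exp (-‖v‖ ^ 2 / R) * v 0) * ((-(z' * Torus.sinCoord 0 x + z * (v 0 * ((2 * Real.pi) * Torus.cosCoord 0 x)))) * (lam⁻¹ * κ x v))|
        = |Real.sqrt (‖v‖ ^ 2) * ((1 + ‖v‖ ^ 2) ^ 4)⁻¹ * Real.exp (-‖v‖ ^ 2 / R) * v 0| *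
            (|(-(z' * Torus.sinCoord 0 x + z * (v 0 * ((2 * Real.pi) * Torus.cosCoord 0 x))))| * |lam⁻¹ * κ x v|) := by
          rw [← abs_mul, ← abs_mul]
      _ ≤ (Real.sqrt (‖v‖ ^ 2) * ((1 + ‖v‖ ^ 2) ^ 4)⁻¹ * Real.exp (-‖v‖ ^ 2 / R) * ‖v‖) *
            ((|z'| * 1 + |z| * (‖v‖ * (2 * Real.pi * 1))) * (lam⁻¹ * (C * (1 + ‖v‖ ^ 2)))) :=
          mul_le_mul hT (mul_le_mul hA hK (abs_nonneg _) (by positivity)) (by positivity)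
            (by positivity)
      _ = _ := by ring
  have hg : Integrable (fun v : EuclideanSpace ℝ (Fin 3) =>
      lam⁻¹ * C * |z'| * (‖v‖ ^ 1 * (Real.sqrt (‖v‖ ^ 2) * ((1 + ‖v‖ ^ 2) ^ 4)⁻¹ * Real.exp (-‖v‖ ^ 2 / R)) +
          ‖v‖ ^ 3 * (Real.sqrt (‖v‖ ^ 2) * ((1 + ‖v‖ ^ 2) ^ 4)⁻¹ * Real.exp (-‖v‖ ^ 2 / R))) +
        lam⁻¹ * C * (2 * Real.pi) * |z| * (‖v‖ ^ 2 * (Real.sqrt (‖v‖ ^ 2) * ((1 + ‖v‖ ^ 2) ^ 4)⁻¹ * Real.exp (-‖v‖ ^ 2 / R)) +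
          ‖v‖ ^ 4 * (Real.sqrt (‖v‖ ^ 2) * ((1 + ‖v‖ ^ 2) ^ 4)⁻¹ * Real.exp (-‖v‖ ^ 2 / R)))) :=
    ((hi1.fun_add hi3).const_mul _).fun_add ((hi2.fun_add hi4).const_mul _)
  have hF : Integrable (fun p : UnitAddTorus (Fin 3) × EuclideanSpace ℝ (Fin 3) => (Real.sqrt (‖p.2‖ ^ 2) * ((1 + ‖p.2‖ ^ 2) ^ 4)⁻¹ * Real.exp (-‖p.2‖ ^ 2 / R) * p.2 0) * ((-(z' * Torus.sinCoord 0 p.1 + z * (p.2 0 * ((2 * Real.pi) * Torus.cosCoord 0 p.1)))) * (lam⁻¹ * κ p.1 p.2))) (volume.prod volume) :=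
    k2r_ref_tk_integrable_prod (by fun_prop (disch := intros; positivity)) hg hFb
  refine ⟨hF, ?_⟩
  -- pass to the product integral and integrate the domination
  have e1 : (∫ x : UnitAddTorus (Fin 3), ∫ v : EuclideanSpace ℝ (Fin 3), (Real.sqrt (‖v‖ ^ 2) * ((1 + ‖v‖ ^ 2) ^ 4)⁻¹ * Real.exp (-‖v‖ ^ 2 / R) * v 0) * ((-(z' * Torus.sinCoord 0 x + z * (v 0 * ((2 * Real.pi) * Torus.cosCoord 0 x)))) * (lam⁻¹ * κ x v))) =
      ∫ p, (Real.sqrt (‖p.2‖ ^ 2) * ((1 + ‖p.2‖ ^ 2) ^ 4)⁻¹ * Real.exp (-‖p.2‖ ^ 2 / R) * p.2 0) * ((-(z' * Torus.sinCoord 0 p.1 + z * (p.2 0 * ((2 * Real.pi) * Torus.cosCoord 0 p.1)))) * (lam⁻¹ * κ p.1 p.2)) ∂((volume : Measure (UnitAddTorus (Fin 3))).prod (volume : Measure (EuclideanSpace ℝ (Fin 3)))) :=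
    (integral_prod _ hF).symm
  rw [e1]
  refine (k2r_ref_tk_abs_integral_prod_le hg hFb).trans ?_
  rw [integral_add ((hi1.fun_add hi3).const_mul _) ((hi2.fun_add hi4).const_mul _),
    integral_const_mul, integral_const_mul, integral_add hi1 hi3, integral_add hi2 hi4, hv4]
  exact k2r_ref_tk_one_arith hlam hC hJ' hI1 hI2 hI3

end Summit.AtomisticToContinuum.HydrodynamicLimit.Theorems.EnskogAdjointDuality

end
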